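import Mathlib
import Literature.NumberTheory.Automorphic.HilbertModularFormQExpansion
import Summits.Langlands.Langlands.Theorems.CapacityClassicalityHilbertIntegralOverconvergentIsCongruenceAbstractEngineMain
import Summits.Langlands.Langlands.Theorems.CapacityClassicalityHilbertIntegralOverconvergentIsCongruenceStubSiegelCountFromGrowth
import Summits.Langlands.Langlands.Theorems.CapacityClassicalityHilbertIntegralOverconvergentIsCongruenceStubGradedSpanAxioms
import Summits.Langlands.Langlands.Theorems.CapacityClassicalityHilbertIntegralOverconvergentIsCongruenceStubRationalFamilyAxioms
import Summits.Langlands.Langlands.Theorems.CapacityClassicalityHilbertIntegralOverconvergentIsCongruenceEngineInstanceData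
import Summits.Langlands.Langlands.Theorems.CapacityClassicalityHilbertIntegralOverconvergentIsCongruenceHilbertClassicalitySturmFamily
import Summits.Langlands.Langlands.Theorems.CapacityClassicalityHilbertIntegralOverconvergentIsCongruenceHilbertClassicalityArchBounds

/-!
# Hilbert classicality modulo the named facts, part 3: the ENGINE INSTANCE — a non-trivial relation among encoded
# `q`-expansions (line `Sketch-ideate-r1-k1`, § T, crux stmt-Langlands-8485)

`hcm_encodedRelation` — the landed `d`-free vector-weight algebraization engine `stub_abstractEngineMain` fed with the Hilbert
instance: `σ = Fin d`, `wt` = total degree, `𝓦 = ℤ^{Hom(F,ℝ)}`, `V b = span_{ℚ̄_p} {map v A | map τ A = enc f, f ∈ M_b(Γ₁(𝔫))}`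
(`stub_rationalFamily_axioms`, `stub_gradedSpan_axioms`), `hSturm` from NAMED FACT (i) (`hcm_sturmFamily`), the Hasse lift and
the Katz datum from the crux's hypothesis (iii), the unknown `g` = the integral encoding of `c`, the auxiliary families =
monomials in the integral encodings of the supplied forms times powers of the supplied form of weight `w₀ - k` (NAMED FACT (ii)),
sizes `hcm_archBounds`, counts `stub_counts` + `stub_siegelCountFromGrowth`, the affine line `hcm_affineLine`.  OUTPUT, read in
`ℂ⟦Fin d⟧` through `τ`: a NON-ZERO coefficient vector `P'` on `{(j, s) : j < D, s ∈ Sym(Fin (d+1), D - j)}` with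
`∑_{(j,s)} P'_{j,s} · (∏_{l ∈ s} enc gf_l) · (enc G₁)^j · Γ^j = 0` for every series `Γ` carrying `τ(c ν)` at `idx ν` and `0` off the
encoded cone (the encoding of the `q`-series of `τ ∘ c`).
-/

set_option linter.dupNamespace false

noncomputable section

namespace Summit.Langlands.Langlands.Theorems.HilbertIntegralOverconvergentIsCongruence

open MeasureTheory Complex NumberField
open Literature.NumberTheory.Automorphic Literature.NumberTheory.Automorphic.HilbertModular
open scoped MatrixGroups NumberField

/-- **The engine instance: a non-trivial relation among encoded `q`-expansions.**  See the module docstring for the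
hypotheses (admissible encoding `(d, idx, α, enc)`; `hSt` = NAMED FACT (i); the supplied forms `gf l ∈ M_{w₀}`, `G₁ ∈ M_{w₀-k}` with
integral `E`-rational tube-convergent expansions = the data of NAMED FACT (ii) without its independence clause; `c` integral with
tube-convergent conjugates; `hKatz` = hypothesis (iii) of the crux) and the conclusion. [folklore] -/
theorem hcm_encodedRelation (F : Type) [Field F] [NumberField F] [NumberField.IsTotallyReal F]
    (hd : 1 < Module.finrank ℚ F) (𝔫 : Ideal (𝓞 F)) (h𝔫 : 𝔫 ≠ ⊥)
    (E : Type) [Field E] [NumberField E] (τ : E →+* ℂ) (p : ℕ) [Fact p.Prime] (v : E →+* PadicAlgCl p)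
    (d : ℕ) (idx : F → (Fin d →₀ ℕ)) (α : F) (enc : (Point F → ℂ) → MvPowerSeries (Fin d) ℂ)
    (hd1 : 1 ≤ d) (hα : ∀ σ : F →+* ℝ, 0 < σ α) (hinj : Set.InjOn idx (qIndexSet F))
    (hadd : ∀ μ ∈ qIndexSet F, ∀ μ' ∈ qIndexSet F, idx (μ + μ') = idx μ + idx μ')
    (htrace : ∀ ν ∈ qIndexSet F, ((∑ j, idx ν j : ℕ) : ℚ) = Algebra.trace ℚ F (α * ν))
    (henc : ∀ f : Point F → ℂ, (∀ μ ∈ qIndexSet F, MvPowerSeries.coeff (idx μ) (enc f) = fourierCoeff f μ) ∧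
      ∀ n, (∀ μ ∈ qIndexSet F, idx μ ≠ n) → MvPowerSeries.coeff n (enc f) = 0)
    (hSt : ∃ (L : ((F →+* ℝ) → ℤ) → ℕ) (cS : ℝ), (∀ b, (L b : ℝ) ≤ cS * (∑ σ, |(b σ : ℝ)| + 1)) ∧
      ∀ (b : (F →+* ℝ) → ℤ) (f : Point F → ℂ), f ∈ modularForms (Bianchi.Gamma1 𝔫) b →
      ∀ q : F → E, (∀ ν ∈ qIndexSet F, fourierCoeff f ν = τ (q ν)) →
      ∀ B : ℝ, 0 ≤ B →
        (∀ ν ∈ qIndexSet F, ((Algebra.trace ℚ F (α * ν) : ℚ) : ℝ) < L b → ‖v (q ν)‖ ≤ B) →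
        ∀ ν ∈ qIndexSet F, ‖v (q ν)‖ ≤ B)
    (k w₀ : (F →+* ℝ) → ℤ) (gf : Fin (d + 1) → Point F → ℂ) (qg : Fin (d + 1) → F → E) (G₁ : Point F → ℂ) (qG : F → E)
    (hgf : ∀ l, gf l ∈ modularForms (Bianchi.Gamma1 𝔫) w₀) (hG₁ : G₁ ∈ modularForms (Bianchi.Gamma1 𝔫) (w₀ - k))
    (hqg : ∀ l, ∀ ν ∈ qIndexSet F, fourierCoeff (gf l) ν = τ (qg l ν)) (hqG : ∀ ν ∈ qIndexSet F, fourierCoeff G₁ ν = τ (qG ν))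
    (hqg_int : ∀ l ν, IsIntegral ℤ (qg l ν)) (hqG_int : ∀ ν, IsIntegral ℤ (qG ν))
    (hqg_arch : ∀ l (τ' : E →+* ℂ) (y : (F →+* ℝ) → ℝ), (∀ σ, 0 < y σ) →
      Summable (fun ν : {ν : F | ∀ b : 𝓞 F, ∃ n : ℤ, Algebra.trace ℚ F (ν * b) = n} ↦
        ‖τ' (qg l ν)‖ * Real.exp (-(2 * Real.pi * ∑ σ : F →+* ℝ, σ (ν : F) * y σ))))
    (hqG_arch : ∀ (τ' : E →+* ℂ) (y : (F →+* ℝ) → ℝ), (∀ σ, 0 < y σ) →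
      Summable (fun ν : {ν : F | ∀ b : 𝓞 F, ∃ n : ℤ, Algebra.trace ℚ F (ν * b) = n} ↦
        ‖τ' (qG ν)‖ * Real.exp (-(2 * Real.pi * ∑ σ : F →+* ℝ, σ (ν : F) * y σ))))
    (c : F → E) (hc_int : ∀ ν, IsIntegral ℤ (c ν))
    (harch_c : ∀ (τ' : E →+* ℂ) (y : (F →+* ℝ) → ℝ), (∀ σ, 0 < y σ) →
      Summable (fun ν : {ν : F | ∀ b : 𝓞 F, ∃ n : ℤ, Algebra.trace ℚ F (ν * b) = n} ↦
        ‖τ' (c ν)‖ * Real.exp (-(2 * Real.pi * ∑ σ : F →+* ℝ, σ (ν : F) * y σ))))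
    (hKatz : ∃ (t : (F →+* ℝ) → ℤ) (e : MvPowerSeries (Fin d) (PadicAlgCl p)) (a : ℕ → MvPowerSeries (Fin d) (PadicAlgCl p))
      (ρ C : ℝ), t ≠ 0 ∧
      e ∈ Submodule.span (PadicAlgCl p)
        {ψ | ∃ (A : MvPowerSeries (Fin d) E) (f : Point F → ℂ), f ∈ modularForms (Bianchi.Gamma1 𝔫) t ∧
          MvPowerSeries.map τ A = enc f ∧ ψ = MvPowerSeries.map v A} ∧
      MvPowerSeries.constantCoeff e = 1 ∧ (∀ n, ‖MvPowerSeries.coeff n e‖ ≤ 1) ∧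
      (∀ i : ℕ, a i ∈ Submodule.span (PadicAlgCl p)
        {ψ | ∃ (A : MvPowerSeries (Fin d) E) (f : Point F → ℂ), f ∈ modularForms (Bianchi.Gamma1 𝔫) (k + i • t) ∧
          MvPowerSeries.map τ A = enc f ∧ ψ = MvPowerSeries.map v A}) ∧
      0 < ρ ∧ ρ < 1 ∧ 0 ≤ C ∧ (∀ i n, ‖MvPowerSeries.coeff n (a i)‖ ≤ C * ρ ^ i) ∧
      (∀ ν ∈ qIndexSet F, HasSum (fun i : ℕ ↦ MvPowerSeries.coeff (idx ν) (a i * e⁻¹ ^ i)) (v (c ν))) ∧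
      ∀ n, (∀ ν ∈ qIndexSet F, idx ν ≠ n) → HasSum (fun i : ℕ ↦ MvPowerSeries.coeff n (a i * e⁻¹ ^ i)) 0) :
    ∃ D : ℕ, 1 ≤ D ∧ ∃ P' : ((j : Fin D) × Sym (Fin (d + 1)) (D - j)) → ℂ, P' ≠ 0 ∧
      ∀ Γ : MvPowerSeries (Fin d) ℂ, (∀ ν ∈ qIndexSet F, MvPowerSeries.coeff (idx ν) Γ = τ (c ν)) →
        (∀ n, (∀ ν ∈ qIndexSet F, idx ν ≠ n) → MvPowerSeries.coeff n Γ = 0) →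
        ∑ u : (j : Fin D) × Sym (Fin (d + 1)) (D - j),
          P' u • ((((u.2 : Multiset (Fin (d + 1))).map (fun l ↦ enc (gf l))).prod * enc G₁ ^ (u.1 : ℕ)) *
            Γ ^ (u.1 : ℕ)) = 0 := by
  classical
  /- ### B. `enc` is THE encoding along `idx`: graded-ring properties on modular forms (§ P, parametric) -/
  obtain ⟨enc₀, henc₀, hmul, haddE, hsmul, hone, -⟩ :=
    eid_qexpRing_of_dict F hd 𝔫 h𝔫 d idx hinj hadd (eid_dict_of_idx F d idx hinj hadd)
  have enc_ext : ∀ (f : Point F → ℂ) (Q : MvPowerSeries (Fin d) ℂ),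
      (∀ μ ∈ qIndexSet F, MvPowerSeries.coeff (idx μ) Q = fourierCoeff f μ) →
      (∀ n, (∀ μ ∈ qIndexSet F, idx μ ≠ n) → MvPowerSeries.coeff n Q = 0) → Q = enc f := by
    intro f Q hQ hQ0
    ext n
    by_cases hn : ∃ μ ∈ qIndexSet F, idx μ = n
    · obtain ⟨μ, hμ, rfl⟩ := hn
      rw [hQ μ hμ, (henc f).1 μ hμ]
    · push Not at hn
      rw [hQ0 n hn, (henc f).2 n hn]
  have hencEq : enc = enc₀ := funext fun f ↦ (enc_ext f (enc₀ f) (henc₀ f).1 (henc₀ f).2).symm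
  rw [← hencEq] at hmul haddE hsmul hone
  /- ### C. the graded family `V b = span_{ℚ̄_p} (v-images of E-rational encoded forms)` and its axioms (§ Q) -/
  set S : ((F →+* ℝ) → ℤ) → Set (MvPowerSeries (Fin d) (PadicAlgCl p)) := fun b ↦
    {ψ | ∃ (A : MvPowerSeries (Fin d) E) (f : Point F → ℂ), f ∈ modularForms (Bianchi.Gamma1 𝔫) b ∧
      MvPowerSeries.map τ A = enc f ∧ ψ = MvPowerSeries.map v A} with hSdef
  set V : ((F →+* ℝ) → ℤ) → Set (MvPowerSeries (Fin d) (PadicAlgCl p)) := fun b ↦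
    (Submodule.span (PadicAlgCl p) (S b) : Set (MvPowerSeries (Fin d) (PadicAlgCl p))) with hVdef
  obtain ⟨h1S, hmulS⟩ := stub_rationalFamily_axioms F 𝔫 d enc hmul hone E τ p v
  have h1 : (1 : MvPowerSeries (Fin d) (PadicAlgCl p)) ∈ S 0 := by
    obtain ⟨A, f, hf, hA, h1⟩ := h1S
    exact ⟨A, f, hf, hA, h1⟩
  have hmul' : ∀ b₁ b₂, ∀ x ∈ S b₁, ∀ y ∈ S b₂, x * y ∈ S (b₁ + b₂) := fun b₁ b₂ x hx y hy ↦ hmulS b₁ b₂ x y hx hy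
  obtain ⟨hV1, hV0, hVadd, hVsmul, hVmul⟩ :=
    stub_gradedSpan_axioms (PadicAlgCl p) ((F →+* ℝ) → ℤ) (MvPowerSeries (Fin d) (PadicAlgCl p)) S h1 hmul'
  /- ### D. the weight (total degree) and its windows (`stub_counts`) -/
  obtain ⟨hwin, cβ, cβ', hcβ, hcnt⟩ := stub_counts d
  let wt : (Fin d →₀ ℕ) →+ ℕ :=
    { toFun := fun n ↦ ∑ j, n j
      map_zero' := by simp
      map_add' := fun a b ↦ by simp [Finset.sum_add_distrib] }
  have hwt : ∀ n, wt n = ∑ j, n j := fun _ ↦ rfl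
  have hfin : ∀ N : ℕ, {ν : Fin d →₀ ℕ | wt ν < N}.Finite := fun N ↦ (hwin N).1
  /- ### E. the sup-norm Sturm principle for `V` from NAMED FACT (i) (`hcm_sturmFamily`) -/
  obtain ⟨L, cS, hLb, hStf⟩ := hSt
  have hSturmV : ∀ b, ∀ T ∈ V b, ∀ B : ℝ, 0 ≤ B →
      (∀ n, wt n < L b → ‖MvPowerSeries.coeff n T‖ ≤ B) → ∀ n, ‖MvPowerSeries.coeff n T‖ ≤ B :=
    fun b T hT B hB hwinT n ↦ hcm_sturmFamily F 𝔫 E τ p v d idx α enc htrace henc haddE hsmul L hStf b T hT B hB hwinT n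
  /- ### F. the Katz datum (hypothesis (iii)) -/
  obtain ⟨t, e, a, ρ, C, ht0, heV, he0, he1, haV, hρ0, hρ1, hC, ha, hsum_cone, hsum_off⟩ := hKatz
  /- ### G. integral lifts and integral encodings; the unknown `g` -/
  have hlift : ∀ x : E, IsIntegral ℤ x → ∃ y : 𝓞 E, algebraMap (𝓞 E) E y = x := fun x hx ↦
    (IsIntegralClosure.isIntegral_iff (A := 𝓞 E)).mp hx
  choose c' hc' using fun ν ↦ hlift (c ν) (hc_int ν)
  let encZ : (F → 𝓞 E) → MvPowerSeries (Fin d) (𝓞 E) := fun q n ↦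
    if h : ∃ ν ∈ qIndexSet F, idx ν = n then q h.choose else 0
  have encZ_cone : ∀ (q : F → 𝓞 E), ∀ ν ∈ qIndexSet F, MvPowerSeries.coeff (idx ν) (encZ q) = q ν := by
    intro q ν hν
    have hex : ∃ μ ∈ qIndexSet F, idx μ = idx ν := ⟨ν, hν, rfl⟩
    show (if h : ∃ μ ∈ qIndexSet F, idx μ = idx ν then q h.choose else 0) = q ν
    rw [dif_pos hex, hinj hex.choose_spec.1 hν hex.choose_spec.2]
  have encZ_off : ∀ (q : F → 𝓞 E) (n : Fin d →₀ ℕ), (∀ ν ∈ qIndexSet F, idx ν ≠ n) →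
      MvPowerSeries.coeff n (encZ q) = 0 := by
    intro q n hn
    have hex : ¬ ∃ μ ∈ qIndexSet F, idx μ = n := fun ⟨μ, hμ, h⟩ ↦ hn μ hμ h
    show (if h : ∃ μ ∈ qIndexSet F, idx μ = n then q h.choose else 0) = 0
    rw [dif_neg hex]
  have encZ_enc : ∀ (q : F → 𝓞 E) (f : Point F → ℂ),
      (∀ ν ∈ qIndexSet F, fourierCoeff f ν = τ (algebraMap (𝓞 E) E (q ν))) →
      MvPowerSeries.map (τ.comp (algebraMap (𝓞 E) E)) (encZ q) = enc f := by
    intro q f hf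
    refine enc_ext f _ (fun μ hμ ↦ ?_) (fun n hn ↦ ?_)
    · rw [MvPowerSeries.coeff_map, encZ_cone q μ hμ, hf μ hμ, RingHom.comp_apply]
    · rw [MvPowerSeries.coeff_map, encZ_off q n hn, map_zero]
  have encZ_coneE : ∀ (q : F → 𝓞 E), ∀ ν ∈ qIndexSet F,
      MvPowerSeries.coeff (idx ν) (MvPowerSeries.map (algebraMap (𝓞 E) E) (encZ q)) = algebraMap (𝓞 E) E (q ν) :=
    fun q ν hν ↦ by rw [MvPowerSeries.coeff_map, encZ_cone q ν hν]
  have encZ_offE : ∀ (q : F → 𝓞 E) (n : Fin d →₀ ℕ), (∀ ν ∈ qIndexSet F, idx ν ≠ n) →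
      MvPowerSeries.coeff n (MvPowerSeries.map (algebraMap (𝓞 E) E) (encZ q)) = 0 :=
    fun q n hn ↦ by rw [MvPowerSeries.coeff_map, encZ_off q n hn, map_zero]
  have hmapmap : ∀ (φ : E →+* PadicAlgCl p) (A : MvPowerSeries (Fin d) (𝓞 E)),
      MvPowerSeries.map (φ.comp (algebraMap (𝓞 E) E)) A =
        MvPowerSeries.map φ (MvPowerSeries.map (algebraMap (𝓞 E) E) A) := by
    intro φ A
    ext n
    simp only [MvPowerSeries.coeff_map, RingHom.comp_apply]
  have hmapmapC : ∀ (φ : E →+* ℂ) (A : MvPowerSeries (Fin d) (𝓞 E)),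
      MvPowerSeries.map (φ.comp (algebraMap (𝓞 E) E)) A =
        MvPowerSeries.map φ (MvPowerSeries.map (algebraMap (𝓞 E) E) A) := by
    intro φ A
    ext n
    simp only [MvPowerSeries.coeff_map, RingHom.comp_apply]
  -- the unknown
  set g : MvPowerSeries (Fin d) (𝓞 E) := encZ c' with hgdef
  have hgc : ∀ ν ∈ qIndexSet F, MvPowerSeries.coeff (idx ν) (MvPowerSeries.map (algebraMap (𝓞 E) E) g) = c ν :=
    fun ν hν ↦ by rw [hgdef, encZ_coneE c' ν hν, hc']
  have hsumg : ∀ n, HasSum (fun i : ℕ ↦ MvPowerSeries.coeff n (a i * e⁻¹ ^ i))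
      (MvPowerSeries.coeff n (MvPowerSeries.map (v.comp (algebraMap (𝓞 E) E)) g)) := by
    intro n
    rw [MvPowerSeries.coeff_map]
    by_cases hn : ∃ ν ∈ qIndexSet F, idx ν = n
    · obtain ⟨ν, hν, rfl⟩ := hn
      rw [hgdef, encZ_cone c' ν hν, RingHom.comp_apply, hc']
      exact hsum_cone ν hν
    · push Not at hn
      rw [hgdef, encZ_off c' n hn, map_zero]
      exact hsum_off n hn
  /- ### I. NAMED FACT (ii): integral encodings of the supplied forms -/
  choose qg' hqg' using fun l ν ↦ hlift (qg l ν) (hqg_int l ν)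
  choose qG' hqG' using fun ν ↦ hlift (qG ν) (hqG_int ν)
  set AZ : Fin (d + 1) → MvPowerSeries (Fin d) (𝓞 E) := fun l ↦ encZ (qg' l) with hAZdef
  have hAZl : ∀ l, AZ l = encZ (qg' l) := fun _ ↦ rfl
  set AG : MvPowerSeries (Fin d) (𝓞 E) := encZ qG' with hAGdef
  set τα : 𝓞 E →+* ℂ := τ.comp (algebraMap (𝓞 E) E) with hτα
  have hταinj : Function.Injective τα := τ.injective.comp (IsFractionRing.injective (𝓞 E) E)
  have hAZτ : ∀ l, MvPowerSeries.map τα (AZ l) = enc (gf l) :=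
    fun l ↦ encZ_enc (qg' l) (gf l) (fun ν hν ↦ by rw [hqg', hqg l ν hν])
  have hAGτ : MvPowerSeries.map τα AG = enc G₁ :=
    encZ_enc qG' G₁ (fun ν hν ↦ by rw [hqG', hqG ν hν])
  have hAZV : ∀ l, MvPowerSeries.map (v.comp (algebraMap (𝓞 E) E)) (AZ l) ∈ V w₀ := by
    intro l
    refine Submodule.subset_span ⟨MvPowerSeries.map (algebraMap (𝓞 E) E) (AZ l), gf l, hgf l, ?_, hmapmap v _⟩
    rw [← hAZτ l, hτα, hmapmapC]
  have hAGV : MvPowerSeries.map (v.comp (algebraMap (𝓞 E) E)) AG ∈ V (w₀ - k) := by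
    refine Submodule.subset_span ⟨MvPowerSeries.map (algebraMap (𝓞 E) E) AG, G₁, hG₁, ?_, hmapmap v _⟩
    rw [← hAGτ, hτα, hmapmapC]
  /- ### J. the auxiliary families: monomials × powers, inside the family `V` -/
  have hVprod : ∀ (b : (F →+* ℝ) → ℤ) (m : Multiset (MvPowerSeries (Fin d) (PadicAlgCl p))),
      (∀ ψ ∈ m, ψ ∈ V b) → m.prod ∈ V (Multiset.card m • b) := by
    intro b m
    induction m using Multiset.induction_on with
    | empty =>
      intro _
      rw [Multiset.prod_zero, Multiset.card_zero, zero_nsmul]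
      exact hV1
    | cons ψ m ih =>
      intro hm
      rw [Multiset.prod_cons, Multiset.card_cons, add_nsmul, one_nsmul, add_comm]
      exact hVmul _ _ _ _ (hm ψ (Multiset.mem_cons_self ψ m)) (ih fun ψ' hψ' ↦ hm ψ' (Multiset.mem_cons_of_mem hψ'))
  have hVpow : ∀ (b : (F →+* ℝ) → ℤ) (ψ : MvPowerSeries (Fin d) (PadicAlgCl p)), ψ ∈ V b →
      ∀ j : ℕ, ψ ^ j ∈ V (j • b) := by
    intro b ψ hψ j
    induction j with
    | zero =>
      rw [pow_zero, zero_nsmul]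
      exact hV1
    | succ j ih =>
      rw [pow_succ, succ_nsmul]
      exact hVmul _ _ _ _ ih hψ
  have hfV : ∀ (D j : ℕ) (s : Sym (Fin (d + 1)) (D - j)), j < D →
      MvPowerSeries.map (v.comp (algebraMap (𝓞 E) E)) (((s : Multiset (Fin (d + 1))).map AZ).prod * AG ^ j) ∈
        V (D • w₀ - j • k) := by
    intro D j s hj
    rw [map_mul, map_pow, map_multiset_prod, Multiset.map_map, ← hcm_nsmul_weight w₀ k D j hj.le]
    refine hVmul _ _ _ _ ?_ (hVpow _ _ hAGV j)
    have h := hVprod w₀ (((s : Multiset (Fin (d + 1))).map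
        (⇑(MvPowerSeries.map (v.comp (algebraMap (𝓞 E) E))) ∘ AZ)))
      (fun ψ hψ ↦ by
        obtain ⟨l, -, rfl⟩ := Multiset.mem_map.1 hψ
        exact hAZV l)
    rwa [Multiset.card_map, Sym.card_coe] at h
  /- ### K. archimedean sizes (`hcm_archBounds`) -/
  have harch : ∀ η : ℝ, 0 < η → ∃ B : ℝ, 1 ≤ B ∧
      (∀ τ' : E →+* ℂ,
        Summable (fun n : Fin d →₀ ℕ ↦ ‖τ' (algebraMap (𝓞 E) E (MvPowerSeries.coeff n g))‖ * Real.exp (-η) ^ wt n) ∧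
        ∑' n : Fin d →₀ ℕ, ‖τ' (algebraMap (𝓞 E) E (MvPowerSeries.coeff n g))‖ * Real.exp (-η) ^ wt n ≤ B) ∧
      (∀ (D j : ℕ) (s : Sym (Fin (d + 1)) (D - j)), j < D → ∀ τ' : E →+* ℂ,
        Summable (fun n : Fin d →₀ ℕ ↦ ‖τ' (algebraMap (𝓞 E) E (MvPowerSeries.coeff n
          (((s : Multiset (Fin (d + 1))).map AZ).prod * AG ^ j)))‖ * Real.exp (-η) ^ wt n) ∧
        ∑' n : Fin d →₀ ℕ, ‖τ' (algebraMap (𝓞 E) E (MvPowerSeries.coeff n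
          (((s : Multiset (Fin (d + 1))).map AZ).prod * AG ^ j)))‖ * Real.exp (-η) ^ wt n ≤ B ^ D) := by
    intro η hη
    obtain ⟨B, hB1, hBg, hBf⟩ := hcm_archBounds F d idx α hα hinj htrace E wt hwt qg qG c hqg_arch hqG_arch harch_c AZ AG g
      (fun l ν hν ↦ by rw [hAZl, encZ_coneE _ ν hν, hqg'])
      (fun l n hn ↦ by rw [hAZl]; exact encZ_offE _ n hn)
      (fun ν hν ↦ by rw [hAGdef, encZ_coneE _ ν hν, hqG'])
      (fun n hn ↦ by rw [hAGdef]; exact encZ_offE _ n hn)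
      hgc (encZ_offE c') η hη
    exact ⟨B, hB1, hBg, fun D j s hj τ' ↦ hBf D j (s : Multiset (Fin (d + 1))) Sym.card_coe hj τ'⟩
  /- ### L. the Siegel count (`stub_counts` + the landed S11) -/
  obtain ⟨N₀, Q, hcount, hgrowth, hQ⟩ :=
    stub_siegelCountFromGrowth d hd1
      (fun D ↦ ∑ j ∈ Finset.range D, Fintype.card (Sym (Fin (d + 1)) (D - j)))
      (fun N ↦ {ν : Fin d →₀ ℕ | wt ν < N}.ncard)
      (by simp)
      (fun N N' hNN' ↦ Set.ncard_le_ncard (fun ν (hν : wt ν < N) ↦ lt_of_lt_of_le hν hNN') (hfin N'))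
      cβ cβ' 1 hcβ one_pos (fun D hD ↦ (hcnt D hD).1) (fun D hD ↦ (hcnt D hD).2.1) (fun D hD ↦ (hcnt D hD).2.2)
      (fun N _ ↦ by
        have h := (hwin N).2
        rw [one_mul]
        exact_mod_cast h)
  /- ### M. the affine Sturm line; N. THE ENGINE -/
  obtain ⟨c₀, ct, c₁, hct, hL⟩ := hcm_affineLine L cS hLb w₀ t ht0
  obtain ⟨D, P, hP0, hrel⟩ :=
    stub_abstractEngineMain p E v (Fin d) wt hfin ((F →+* ℝ) → ℤ) V hV1 hV0 hVadd hVsmul hVmul L hSturmV e t he0 he1 heV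
      g k a haV ρ C hρ0 hρ1 hC ha hsumg w₀ c₀ ct c₁ hct hL (fun D j ↦ Sym (Fin (d + 1)) (D - j))
      (fun D j s ↦ ((s : Multiset (Fin (d + 1))).map AZ).prod * AG ^ j) hfV harch N₀ hcount hgrowth Q hQ
  /- ### O. a non-zero coefficient; `D ≥ 1` -/
  set P' : ((j : Fin D) × Sym (Fin (d + 1)) (D - j)) → ℂ := fun u ↦ τα (P u) with hP'def
  have hP'0 : P' ≠ 0 := by
    intro h
    apply hP0
    funext u
    have hu : τα (P u) = 0 := congrFun h u
    exact hταinj (by rw [hu, Pi.zero_apply, map_zero])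
  have hD1 : 1 ≤ D := by
    obtain ⟨u, -⟩ := Function.ne_iff.1 hP'0
    rcases Nat.eq_zero_or_pos D with hD | hD
    · subst hD
      exact u.1.elim0
    · exact hD
  /- ### P. the relation among ENCODINGS: `map τα` of the engine's relation -/
  have hrelC : ∑ u : (j : Fin D) × Sym (Fin (d + 1)) (D - j),
      P' u • (MvPowerSeries.map τα (((u.2 : Multiset (Fin (d + 1))).map AZ).prod * AG ^ (u.1 : ℕ)) *
        MvPowerSeries.map τα g ^ (u.1 : ℕ)) = 0 := by
    have h := congrArg (MvPowerSeries.map τα) hrel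
    rw [map_zero, map_sum] at h
    rw [← h]
    refine Finset.sum_congr rfl fun u _ ↦ ?_
    simp only [hP'def]
    conv_rhs => rw [MvPowerSeries.smul_eq_C_mul, map_mul, MvPowerSeries.map_C, map_mul, map_pow]
    rw [MvPowerSeries.smul_eq_C_mul]
  have hmapf : ∀ (j : ℕ) (s : Multiset (Fin (d + 1))),
      MvPowerSeries.map τα ((s.map AZ).prod * AG ^ j) = (s.map (fun l ↦ enc (gf l))).prod * enc G₁ ^ j := by
    intro j s
    rw [map_mul, map_pow, map_multiset_prod, Multiset.map_map, hAGτ]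
    congr 2
    exact Multiset.map_congr rfl fun l _ ↦ hAZτ l
  refine ⟨D, hD1, P', hP'0, fun Γ hΓc hΓo ↦ ?_⟩
  have hgΓ : MvPowerSeries.map τα g = Γ := by
    ext n
    by_cases hn : ∃ μ ∈ qIndexSet F, idx μ = n
    · obtain ⟨μ, hμ, rfl⟩ := hn
      rw [MvPowerSeries.coeff_map, hgdef, encZ_cone c' μ hμ, hΓc μ hμ, hτα, RingHom.comp_apply, hc']
    · push Not at hn
      rw [MvPowerSeries.coeff_map, hgdef, encZ_off c' n hn, map_zero, hΓo n hn]
  rw [← hrelC]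
  refine Finset.sum_congr rfl fun u _ ↦ ?_
  rw [hmapf, hgΓ]

end Summit.Langlands.Langlands.Theorems.HilbertIntegralOverconvergentIsCongruence

end
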